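import Summits.QuantumFields.BalabanUV.Beta.GAN24.PeriodicKKTResponse
import Summits.QuantumFields.BalabanUV.Beta.GAN24.PeriodicCellPairing
import Summits.QuantumFields.BalabanUV.Beta.GAN24.PeriodicForceMultiplier
import Literature.MathematicalPhysics.QuantumFieldTheory.Balaban1983to89.Beta.ResolventComposition

/-!
# `BalabanUV.Beta.GAN24.PeriodicKKTResponseFlux` — binder row G-an2-4 ∕ (CONV-C), W-slot CT-W, conservation law (C)∕(C)sym: **THE RESOLVENT FLUX IDENTITY
# `curv (Γ_N·J) = ½(avg F − F)` FOR THE RESPONSE OF THE `U = 1` KKT RESOLVENT TO THE BLOCK-PERIODIC CURRENT `J = −½·curvAdj F`** — the constraint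
# multiplier of the superposed response reads only the cell totals of the force (zero for a current), its gauge row is `dz` of a block-periodic
# potential, hence the Euler–Lagrange row in potential form and, by `GAN24.PeriodicCellPairing` ∕ `GAN24.HarmonicPeriodicTwoForm`, the flux identity
# (step (P2) part 2 + the end of route (d′) of this lineage's note `HOME/b2b-balaban-gan24-formalise-leaf-04/g64/CSYM-D3-ANATOMY.md` §8; generic `d`,
# every block factor `N ≥ 1`, every block-periodic antisymmetric closed 2-form `F`)

NOT IN PRINT; OUR BOOKKEEPING ([folklore] tsum bookkeeping BY NAME over an2∕an5's `KKTFluctuationKernel` (`Gam ∕ GamΦ ∕ GamM`, `Gam_EL`), the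
antisymmetry `ResolventComposition.GamΦ_eq_neg_wH` (`ℋ♭ = −ℋᵀ`), the constant reproduction of the minimiser kernel `KernelSpecInstance.lowMomentsSum_specK`
((Q-lin)) in the `y`-form `KernelRepresentationSummable.constReproSum_iff_decimated`, an5's `ResolventCompositionStepB` §9.2 interchange lemmas
(`dz_tsum ∕ codiff₁_tsum ∕ contourSumAdj_tsum ∕ dz_finsum_mul ∕ codiff₁_finsum_mul ∕ contourSumAdj_finsum_mul`), leaf-02's periodic regrouping
`GAN24.BiStencilZeroMode.tsum_mul_periodic`, and this lineage's `GAN24.PeriodicKKTResponse` (part 1), `GAN24.PeriodicForceMultiplier.bounded_of_periodic`,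
`GAN24.PeriodicCellPairing.sum_box_curvAdj_mul ∕ card_mul_curv_add_half_eq`; G-an2-4 formalisation swarm, leaf prover `b2b-balaban-gan24-formalise-leaf-04`,
gen 65).  HONEST FRAMING (cell contract, verbatim): «discharging `BetaPertH` makes Bałaban's UV stability UNCONDITIONAL — a real constructive-QFT result; it
is NOT the continuum limit and NOT the Clay problem.»  HONEST DEPENDENCY (verbatim): «continuum YM on T⁴ ⇐ BetaPertH ∧ nine spine estimates (0/9 proved);
BetaPertH ⇐ (D1) ∧ (D4) ∧ CAP+tail; G-an2-4 gates asym, D1 and NE2/3/4.»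

WHY (note §3 (c)–(d) ∕ §7 ∕ §8 (d′)): in the dressed one-step zero mode at level 0 the cubic × cubic Wilson exchange word is the cell pairing `⟨J′, Γ·J⟩_cell` of
two block-periodic EDGE CURRENTS (`GAN24.WilsonEdgeCurrent`: `J = −½·curvAdj (p ⊗ q)`, `GAN24.PeriodicCellPairing.edgeCurrent_eq_neg_half_curvAdj`); by
`sum_box_curvAdj_mul` that pairing is `−½·Σ_cell F′·curv (Γ·J)`, and THIS FILE computes `curv (Γ·J) = ½(avg F − F)` exactly — in-plane flux `½(N⁻²·|column| −
𝟙_column)`, zero across planes; with the pins `cE₂ = cE²` this is the located law «exchange = −(Lc² − 1) × undressed quartic contact» (ENGINE-indicated at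
d+1 = 2, 3, 4 and Lc = 3, 5, 9; kit j167031 ∕ j168341 ∕ j168345 ∕ j169947).  No Green's function, no Fourier analysis, no estimate: (Q-lin) kills the multiplier,
a current is divergence-free so the gauge term drops, and a harmonic block-periodic 2-form is constant.

WHAT ([folklore]; 0 `def`, 0 cited facts, 0 `def … : Prop`, 0 sorry): §1 **`hasSum_GamΦ_coarse`** (`Σ_q Γ^Φ κ q l y = −δ_{lκ}·N^{−(d+2)}`), `summable_mul_GamΦ`,
**`tsum_mul_GamΦ_periodic`** (the multiplier of the superposed response `φ κ q = −N^{−(d+2)}·Σ_{r ∈ box} J κ (toSite r)`), `tsum_mul_GamΦ_eq_zero`; §2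
`summable_mul_GamM ∕ summable_sum_mul_GamM`, `respM_periodic`, **`dz_codiff_dz_respM`** (the gauge row passes through the superposition); §3
`summable_sum_mul_contourSumAdj_GamΦ`, `tsum_sum_mul_contourSumAdj_GamΦ_eq_zero`, **`curvAdj_curv_resp_eq_dz_add`** (`curvAdj (curv A) = dz g + J` with the
block-periodic gauge potential `g = codiff₁ (dz M)`); §4 `sum_box_curvAdj_eq_zero`, `current_periodic`, `current_bounded`, **`card_mul_curv_resp_add_half_eq`**
(`|box|·(curv A κ l x + ½·F κ l x) = ½·Σ_{r ∈ box} F κ l (toSite r)` for `A = Γ_N·(−½·curvAdj F)`).  Asserts NO value of Bałaban's tables; discharges NOTHING of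
(C)sym ∕ (Q-D) ∕ (Q-D-rate) ∕ «T2Shape» ∕ «T2Drift» ∕ (hW, hWall); NEVER «G-an2-4 closed» as (CONV-C); NOT D1, NOT `BetaPertH`, NOT continuum, NOT Clay.
2026-08-22; no existing file touched.
-/

noncomputable section

open Finset
open scoped BigOperators
open Literature.MathematicalPhysics.QuantumFieldTheory
open Literature.MathematicalPhysics.QuantumFieldTheory.Balaban1983to89.Beta
open Literature.Probability.LatticeModels (TorusSite Torus.proj Torus.proj_apply)
open AffineAveraging (Form0 Form1 Form2 unitVec dz curv curvAdj codiff₁ box toSite)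
open LatticeForm (repZ quo proj_repZ proj_add_zsmul)
open BlochFibreUniqueness (quo_add_zsmul)
open KKTFluctuationKernel (Gam GamΦ GamM decay_Gam Gam_EL)
open AffineReproduction (contourSumAdj)
open KKTFluctuationEnergy (summable_mul_of_bdd summable_mul_of_bdd')
open PeriodicDescent (IsPeriodic)
open KernelSpecInstance (wH lowMomentsSum_specK)
open KernelRepresentationSummable (constReproSum_iff_decimated)
open Summit.QuantumFields.BalabanUV.Beta.GAN24.PeriodicKKTResponse (Gam_add_zsmul GamΦ_add GamM_add_zsmul summable_Gam
  summable_mul_Gam summable_sum_mul_Gam respA_periodic summable_GamΦ summable_GamM curvAdj_curv_resp_eq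
  summable_sum_mul_curvAdj_curv_Gam)
open Summit.QuantumFields.BalabanUV.Beta.GAN24.BiStencilZeroMode (tsum_mul_periodic)

namespace Summit.QuantumFields.BalabanUV.Beta.GAN24.PeriodicKKTResponseFlux

variable {d N : ℕ} [NeZero N]

/-! ## §1 The constraint multiplier of the superposed response reads only the cell totals of the force -/

/-- [folklore] **THE COARSE ROW SUM OF `Γ^Φ`** ((Q-lin) through `ℋ♭ = −ℋᵀ`): for every fine source bond `(l, y)` and every coarse direction `κ`,
`Σ_q Γ^Φ κ q l y = −δ_{lκ}·N^{−(d+2)}` (`ResolventComposition.GamΦ_eq_neg_wH` + the constant reproduction `KernelSpecInstance.lowMomentsSum_specK`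
of the minimiser kernel `wH`, in the `y`-form `KernelRepresentationSummable.constReproSum_iff_decimated`). -/
theorem hasSum_GamΦ_coarse (κ l : Fin (d + 1)) (y : AffineAveraging.Site (d + 1)) :
    HasSum (fun q : AffineAveraging.Site (d + 1) => GamΦ (N := N) κ q l y)
      (-(if l = κ then ((N : ℝ) ^ (d + 1 + 1))⁻¹ else 0)) := by
  have h := (constReproSum_iff_decimated (NeZero.ne N) (wH (N := N) l κ) _).1 ((lowMomentsSum_specK (N := N) (d := d)).1 l κ) y
  refine h.neg.congr_fun fun q => ?_
  rw [ResolventComposition.GamΦ_eq_neg_wH]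

/-- [folklore] The `Γ^Φ`-row against a bounded force is summable in the source. -/
theorem summable_mul_GamΦ {J : Form1 (d + 1) ℝ} {B : ℝ} (hJ : ∀ l y, |J l y| ≤ B) (κ : Fin (d + 1)) (q : AffineAveraging.Site (d + 1))
    (l : Fin (d + 1)) : Summable fun y => J l y * GamΦ (N := N) κ q l y :=
  summable_mul_of_bdd (fun y => hJ l y) (summable_GamΦ (N := N) κ q l)

/-- [folklore] **THE CONSTRAINT MULTIPLIER OF THE SUPERPOSED RESPONSE TO A BLOCK-PERIODIC FORCE READS ONLY ITS CELL TOTALS**: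
`φ κ q := Σ'_y Σ_l J l y·Γ^Φ κ q l y = −N^{−(d+2)}·Σ_{r ∈ box} J κ (toSite r)` for every coarse bond `(κ, q)` (periodic regrouping
`BiStencilZeroMode.tsum_mul_periodic`, block covariance `GamΦ_add`, and the coarse row sum `hasSum_GamΦ_coarse`). -/
theorem tsum_mul_GamΦ_periodic {J : Form1 (d + 1) ℝ} {B : ℝ} (hJ : ∀ l y, |J l y| ≤ B) (hJp : ∀ l y t, J l (y + (N : ℤ) • t) = J l y)
    (κ : Fin (d + 1)) (q : AffineAveraging.Site (d + 1)) :
    ∑' y, ∑ l, J l y * GamΦ (N := N) κ q l y = -((N : ℝ) ^ (d + 1 + 1))⁻¹ * ∑ r ∈ box (d + 1) N, J κ (toSite r) := by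
  rw [Summable.tsum_finsetSum (fun l _ => summable_mul_GamΦ (N := N) hJ κ q l)]
  have hl : ∀ l, ∑' y, J l y * GamΦ (N := N) κ q l y =
      -(if l = κ then ((N : ℝ) ^ (d + 1 + 1))⁻¹ else 0) * ∑ r ∈ box (d + 1) N, J l (toSite r) := by
    intro l
    have hs : Summable fun y => GamΦ (N := N) κ q l y * J l y := by
      simpa only [mul_comm] using summable_mul_GamΦ (N := N) hJ κ q l
    have e1 : ∑' y, J l y * GamΦ (N := N) κ q l y = ∑' y, GamΦ (N := N) κ q l y * J l y :=
      tsum_congr fun y => mul_comm _ _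
    rw [e1, tsum_mul_periodic (N := N) (fun u t => hJp l u t) hs, Finset.mul_sum]
    refine Finset.sum_congr rfl fun r _ => ?_
    have hcov : ∀ t : AffineAveraging.Site (d + 1), GamΦ (N := N) κ q l ((N : ℤ) • t + toSite r) = GamΦ (N := N) κ (q - t) l (toSite r) := by
      intro t
      have e := GamΦ_add (N := N) κ (q - t) l (toSite r) t
      rw [sub_add_cancel, add_comm (toSite r)] at e
      exact e
    simp_rw [hcov]
    have hre : ∑' t : AffineAveraging.Site (d + 1), GamΦ (N := N) κ (q - t) l (toSite r) =
        ∑' q' : AffineAveraging.Site (d + 1), GamΦ (N := N) κ q' l (toSite r) :=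
      (Equiv.subLeft q).tsum_eq (fun q' : AffineAveraging.Site (d + 1) => GamΦ (N := N) κ q' l (toSite r))
    rw [hre, (hasSum_GamΦ_coarse (N := N) κ l (toSite r)).tsum_eq]
    ring
  simp_rw [hl]
  simp only [neg_mul, ite_mul, zero_mul, Finset.sum_neg_distrib, Finset.sum_ite_eq', Finset.mem_univ, if_true]

/-- [folklore] **… HENCE ZERO FOR A FORCE WITH ZERO CELL TOTALS** (every block-periodic current). -/
theorem tsum_mul_GamΦ_eq_zero {J : Form1 (d + 1) ℝ} {B : ℝ} (hJ : ∀ l y, |J l y| ≤ B) (hJp : ∀ l y t, J l (y + (N : ℤ) • t) = J l y)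
    (hJ0 : ∀ l, ∑ r ∈ box (d + 1) N, J l (toSite r) = 0) (κ : Fin (d + 1)) (q : AffineAveraging.Site (d + 1)) :
    ∑' y, ∑ l, J l y * GamΦ (N := N) κ q l y = 0 := by
  rw [tsum_mul_GamΦ_periodic (N := N) hJ hJp, hJ0, mul_zero]

/-! ## §2 The gauge potential of the superposed response: summability, block-periodicity, interchange -/

/-- [folklore] The `Γ^M`-row against a bounded force is summable in the source. -/
theorem summable_mul_GamM {J : Form1 (d + 1) ℝ} {B : ℝ} (hJ : ∀ l y, |J l y| ≤ B) (z : AffineAveraging.Site (d + 1)) (l : Fin (d + 1)) :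
    Summable fun y => J l y * GamM (N := N) z l y :=
  summable_mul_of_bdd (fun y => hJ l y) (summable_GamM (N := N) z l)

/-- [folklore] … summed over the source direction. -/
theorem summable_sum_mul_GamM {J : Form1 (d + 1) ℝ} {B : ℝ} (hJ : ∀ l y, |J l y| ≤ B) (z : AffineAveraging.Site (d + 1)) :
    Summable fun y => ∑ l, J l y * GamM (N := N) z l y :=
  summable_sum fun l _ => summable_mul_GamM (N := N) hJ z l

/-- [folklore] The superposed gauge-multiplier potential `M z := Σ'_y Σ_l J l y · Γ^M z l y` of a block-periodic force is block-periodic. -/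
theorem respM_periodic {J : Form1 (d + 1) ℝ} (hJp : ∀ l y t, J l (y + (N : ℤ) • t) = J l y) (z t : AffineAveraging.Site (d + 1)) :
    ∑' y, ∑ l, J l y * GamM (N := N) (z + (N : ℤ) • t) l y = ∑' y, ∑ l, J l y * GamM (N := N) z l y := by
  rw [← (Equiv.addRight ((N : ℤ) • t)).tsum_eq (fun y => ∑ l, J l y * GamM (N := N) (z + (N : ℤ) • t) l y)]
  refine tsum_congr fun y => Finset.sum_congr rfl fun l _ => ?_
  simp only [Equiv.coe_addRight, GamM_add_zsmul, hJp]

/-- [folklore] **THE GAUGE ROW PASSES THROUGH THE SUPERPOSITION**: `dz (codiff₁ (dz M)) μ x = Σ'_y Σ_l J l y · dz (codiff₁ (dz Γ^M-col)) μ x`. -/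
theorem dz_codiff_dz_respM {J : Form1 (d + 1) ℝ} {B : ℝ} (hJ : ∀ l y, |J l y| ≤ B) (μ : Fin (d + 1)) (x : AffineAveraging.Site (d + 1)) :
    dz (codiff₁ (dz (fun z => ∑' y, ∑ l, J l y * GamM (N := N) z l y))) μ x =
      ∑' y, ∑ l, J l y * dz (codiff₁ (dz (fun z => GamM (N := N) z l y))) μ x := by
  have hs0 : ∀ z, Summable fun y => ∑ l, J l y * GamM (N := N) z l y := fun z => summable_sum_mul_GamM (N := N) hJ z
  rw [ResolventCompositionStepB.dz_tsum (f := fun y z => ∑ l, J l y * GamM (N := N) z l y) hs0]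
  have hs1 : ∀ κ z, Summable fun y => dz (fun z => ∑ l, J l y * GamM (N := N) z l y) κ z := fun κ z =>
    (hs0 (z + unitVec κ)).sub (hs0 z)
  rw [ResolventCompositionStepB.codiff₁_tsum hs1]
  have hs2 : ∀ z, Summable fun y => codiff₁ (dz (fun z => ∑ l, J l y * GamM (N := N) z l y)) z := fun z =>
    summable_sum fun κ _ => (hs1 κ (z - unitVec κ)).sub (hs1 κ z)
  rw [ResolventCompositionStepB.dz_tsum hs2]
  refine tsum_congr fun y => ?_
  rw [show (fun z => ∑ l, J l y * GamM (N := N) z l y) = fun z => ∑ l ∈ Finset.univ, J l y * (fun l z => GamM (N := N) z l y) l z from rfl,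
    ResolventCompositionStepB.dz_finsum_mul, ResolventCompositionStepB.codiff₁_finsum_mul, ResolventCompositionStepB.dz_finsum_mul]

/-! ## §3 The Euler–Lagrange row of the response to a block-periodic current, potential form -/

/-- [folklore] Summability of the `Γ^Φ`-part of the columns' Euler–Lagrange values against a bounded force. -/
theorem summable_sum_mul_contourSumAdj_GamΦ {J : Form1 (d + 1) ℝ} {B : ℝ} (hJ : ∀ l y, |J l y| ≤ B) (μ : Fin (d + 1))
    (x : AffineAveraging.Site (d + 1)) :
    Summable fun y => ∑ l, J l y * contourSumAdj N (fun κ q => GamΦ (N := N) κ q l y) μ x := by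
  simp_rw [KKTFluctuationEnergy.contourSumAdj_eq, Finset.mul_sum]
  exact summable_sum fun l _ => summable_sum fun s _ => summable_mul_GamΦ (N := N) hJ μ _ l

/-- [folklore] The `Γ^Φ`-part of the superposed Euler–Lagrange row is `𝒬ᵀ` of the superposed multiplier — ZERO for a force with zero cell totals. -/
theorem tsum_sum_mul_contourSumAdj_GamΦ_eq_zero {J : Form1 (d + 1) ℝ} {B : ℝ} (hJ : ∀ l y, |J l y| ≤ B)
    (hJp : ∀ l y t, J l (y + (N : ℤ) • t) = J l y) (hJ0 : ∀ l, ∑ r ∈ box (d + 1) N, J l (toSite r) = 0) (μ : Fin (d + 1))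
    (x : AffineAveraging.Site (d + 1)) :
    ∑' y, ∑ l, J l y * contourSumAdj N (fun κ q => GamΦ (N := N) κ q l y) μ x = 0 := by
  have e1 : ∀ y, ∑ l, J l y * contourSumAdj N (fun κ q => GamΦ (N := N) κ q l y) μ x =
      contourSumAdj N (fun κ q => ∑ l, J l y * GamΦ (N := N) κ q l y) μ x := by
    intro y
    rw [show (fun κ q => ∑ l, J l y * GamΦ (N := N) κ q l y) = fun κ q => ∑ l ∈ Finset.univ, J l y * (fun l κ q => GamΦ (N := N) κ q l y) l κ q
      from rfl, ResolventCompositionStepB.contourSumAdj_finsum_mul]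
  simp_rw [e1]
  have hs : ∀ κ q, Summable fun y => ∑ l, J l y * GamΦ (N := N) κ q l y := fun κ q =>
    summable_sum fun l _ => summable_mul_GamΦ (N := N) hJ κ q l
  have e2 := congrFun (congrFun (ResolventCompositionStepB.contourSumAdj_tsum N (f := fun y κ q => ∑ l, J l y * GamΦ (N := N) κ q l y) hs) μ) x
  rw [← e2]
  have e3 : (fun κ q => ∑' y, ∑ l, J l y * GamΦ (N := N) κ q l y) = fun _ _ => (0 : ℝ) := by
    funext κ q
    exact tsum_mul_GamΦ_eq_zero (N := N) hJ hJp hJ0 κ q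
  rw [e3]
  simp [KKTFluctuationEnergy.contourSumAdj_eq]

/-- [folklore] **THE EULER–LAGRANGE ROW OF THE RESPONSE TO A BLOCK-PERIODIC CURRENT, POTENTIAL FORM**: for a bounded block-periodic force `J` with zero
cell totals, the superposed response `A κ x := Σ'_y Σ_l J l y·Γ κ x l y` solves `curvAdj (curv A) = dz g + J` with the block-periodic gauge potential
`g := codiff₁ (dz M)`, `M z := Σ'_y Σ_l J l y·Γ^M z l y` — the averaging multiplier has dropped out (§1). -/
theorem curvAdj_curv_resp_eq_dz_add {J : Form1 (d + 1) ℝ} {B : ℝ} (hJ : ∀ l y, |J l y| ≤ B) (hJp : ∀ l y t, J l (y + (N : ℤ) • t) = J l y)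
    (hJ0 : ∀ l, ∑ r ∈ box (d + 1) N, J l (toSite r) = 0) (μ : Fin (d + 1)) (x : AffineAveraging.Site (d + 1)) :
    curvAdj (curv (fun κ x => ∑' y, ∑ l, J l y * Gam (N := N) κ x l y)) μ x =
      dz (codiff₁ (dz (fun z => ∑' y, ∑ l, J l y * GamM (N := N) z l y))) μ x + J μ x := by
  rw [curvAdj_curv_resp_eq (N := N) hJ μ x, dz_codiff_dz_respM (N := N) hJ μ x]
  congr 1
  have hΦ := summable_sum_mul_contourSumAdj_GamΦ (N := N) hJ μ x
  -- the combined (Φ + M) column values are summable: total EL values minus the resummed delta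
  have htot := summable_sum_mul_curvAdj_curv_Gam (N := N) hJ μ x
  have hδs : Summable fun y => if x = y then J μ y else 0 := by
    apply summable_of_ne_finset_zero (s := {x})
    intro y hy
    rw [Finset.mem_singleton] at hy
    simp [Ne.symm hy]
  have hcomb : Summable fun y => ∑ l, J l y * (contourSumAdj N (fun κ q => GamΦ (N := N) κ q l y) μ x
      + dz (codiff₁ (dz (fun z => GamM (N := N) z l y))) μ x) := by
    have e : ∀ y, ∑ l, J l y * (contourSumAdj N (fun κ q => GamΦ (N := N) κ q l y) μ x
        + dz (codiff₁ (dz (fun z => GamM (N := N) z l y))) μ x) =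
        ∑ l, J l y * curvAdj (curv (fun κ z => Gam (N := N) κ z l y)) μ x - (if x = y then J μ y else 0) := by
      intro y
      simp only [Gam_EL, mul_add, Finset.sum_add_distrib]
      by_cases hxy : x = y
      · subst hxy
        simp only [and_true, if_true, mul_ite, mul_one, mul_zero]
        rw [Finset.sum_ite_eq Finset.univ μ (fun l => J l x)]
        simp
      · simp [hxy]
    simp_rw [e]
    exact htot.sub hδs
  have hM : Summable fun y => ∑ l, J l y * dz (codiff₁ (dz (fun z => GamM (N := N) z l y))) μ x := by
    have e : ∀ y, ∑ l, J l y * dz (codiff₁ (dz (fun z => GamM (N := N) z l y))) μ x =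
        ∑ l, J l y * (contourSumAdj N (fun κ q => GamΦ (N := N) κ q l y) μ x + dz (codiff₁ (dz (fun z => GamM (N := N) z l y))) μ x)
          - ∑ l, J l y * contourSumAdj N (fun κ q => GamΦ (N := N) κ q l y) μ x := by
      intro y
      rw [← Finset.sum_sub_distrib]
      exact Finset.sum_congr rfl fun l _ => by ring
    simp_rw [e]
    exact hcomb.sub hΦ
  have esplit : ∀ y, ∑ l, J l y * (contourSumAdj N (fun κ q => GamΦ (N := N) κ q l y) μ x
      + dz (codiff₁ (dz (fun z => GamM (N := N) z l y))) μ x) =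
      ∑ l, J l y * contourSumAdj N (fun κ q => GamΦ (N := N) κ q l y) μ x
        + ∑ l, J l y * dz (codiff₁ (dz (fun z => GamM (N := N) z l y))) μ x := by
    intro y
    rw [← Finset.sum_add_distrib]
    exact Finset.sum_congr rfl fun l _ => by ring
  rw [tsum_congr esplit, hΦ.tsum_add hM, tsum_sum_mul_contourSumAdj_GamΦ_eq_zero (N := N) hJ hJp hJ0 μ x, zero_add]

/-! ## §4 The resolvent flux identity for the response to the current `−½·curvAdj F` -/

/-- [folklore] A block-periodic 2-form has a `curvAdj` with zero cell totals (pair it with the constant 1-forms: `sum_box_curvAdj_mul` and `curv (const) = 0`). -/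
theorem sum_box_curvAdj_eq_zero {F : Form2 (d + 1) ℝ} (hF : ∀ κ l, IsPeriodic N (F κ l)) (μ : Fin (d + 1)) :
    ∑ r ∈ box (d + 1) N, curvAdj F μ (toSite r) = 0 := by
  have h := PeriodicCellPairing.sum_box_curvAdj_mul (N := N) hF (A := fun κ _ => if κ = μ then (1 : ℝ) else 0) (fun κ x a => rfl)
  have hc : curv (fun κ (_ : AffineAveraging.Site (d + 1)) => if κ = μ then (1 : ℝ) else 0) = 0 := by
    funext κ l x
    simp only [curv, Pi.zero_apply]
    ring
  simp only [hc, Pi.zero_apply, mul_zero, Finset.sum_const_zero, mul_ite, mul_one, Finset.sum_ite_eq', Finset.mem_univ, if_true] at h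
  exact h

omit [NeZero N] in
/-- [folklore] The current `−½·curvAdj F` of a block-periodic 2-form is block-periodic. -/
theorem current_periodic {F : Form2 (d + 1) ℝ} (hF : ∀ κ l, IsPeriodic N (F κ l)) (l : Fin (d + 1)) (y t : AffineAveraging.Site (d + 1)) :
    -(1 / 2 : ℝ) * curvAdj F l (y + (N : ℤ) • t) = -(1 / 2 : ℝ) * curvAdj F l y := by
  congr 1
  simp only [curvAdj]
  congr 1
  · refine Finset.sum_congr rfl fun k _ => ?_
    rw [show y + (N : ℤ) • t - unitVec k = (y - unitVec k) + (N : ℤ) • t by abel, hF, hF]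
  · refine Finset.sum_congr rfl fun k _ => ?_
    rw [show y + (N : ℤ) • t - unitVec k = (y - unitVec k) + (N : ℤ) • t by abel, hF, hF]

/-- [folklore] The current `−½·curvAdj F` of a block-periodic 2-form is bounded (it is block-periodic: `PeriodicForceMultiplier.bounded_of_periodic`). -/
theorem current_bounded {F : Form2 (d + 1) ℝ} (hF : ∀ κ l, IsPeriodic N (F κ l)) :
    ∀ l y, |-(1 / 2 : ℝ) * curvAdj F l y| ≤ ∑ l', ∑ r ∈ box (d + 1) N, |-(1 / 2 : ℝ) * curvAdj F l' (toSite r)| := by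
  intro l y
  have h := PeriodicForceMultiplier.bounded_of_periodic (Lc := N) (V := fun y => -(1 / 2 : ℝ) * curvAdj F l y)
    (fun y t => current_periodic (N := N) hF l y t) y
  exact h.trans (Finset.single_le_sum (f := fun l' => ∑ r ∈ box (d + 1) N, |-(1 / 2 : ℝ) * curvAdj F l' (toSite r)|)
    (fun l' _ => Finset.sum_nonneg fun r _ => abs_nonneg _) (Finset.mem_univ l))

/-- [folklore] **THE RESOLVENT FLUX IDENTITY** (note §8 (d′), the end of steps (i)–(v); generic `d`, every block factor `N ≥ 1`): let `F` be a block-periodic,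
antisymmetric, closed 2-form on `ℤ^{d+1}` and `A κ x := Σ'_y Σ_l J l y·Γ_N κ x l y` the response of the `U = 1` KKT resolvent to the current `J := −½·curvAdj F`.
Then `curv A + ½F` is the constant 2-form `½·avg F`: `|box|·(curv A κ l x + ½·F κ l x) = ½·Σ_{r ∈ box} F κ l (toSite r)` for every `κ l x` — i.e.
`curv (Γ·J) = ½(avg F − F)`.  (§3 for the potential form of the Euler–Lagrange row, the multiplier having dropped by §1 since a current has zero cell
totals; then `PeriodicCellPairing.card_mul_curv_add_half_eq`: the gauge term drops, `curv A + ½F` is harmonic, hence constant by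
`HarmonicPeriodicTwoForm`.) -/
theorem card_mul_curv_resp_add_half_eq {F : Form2 (d + 1) ℝ} (hF : ∀ κ l, IsPeriodic N (F κ l)) (hFa : ∀ κ l x, F κ l x = -F l κ x)
    (hFcl : ∀ (κ l m : Fin (d + 1)) (x : AffineAveraging.Site (d + 1)),
      (F l m (x + unitVec κ) - F l m x) + (F m κ (x + unitVec l) - F m κ x) + (F κ l (x + unitVec m) - F κ l x) = 0)
    (κ l : Fin (d + 1)) (x : AffineAveraging.Site (d + 1)) :
    ((box (d + 1) N).card : ℝ) *
        (curv (fun κ x => ∑' y, ∑ l, (-(1 / 2 : ℝ) * curvAdj F l y) * Gam (N := N) κ x l y) κ l x + (1 / 2 : ℝ) * F κ l x) =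
      (1 / 2 : ℝ) * ∑ r ∈ box (d + 1) N, F κ l (toSite r) := by
  have hJ := current_bounded (N := N) hF
  have hJp : ∀ l y t, -(1 / 2 : ℝ) * curvAdj F l (y + (N : ℤ) • t) = -(1 / 2 : ℝ) * curvAdj F l y := current_periodic (N := N) hF
  have hJ0 : ∀ l, ∑ r ∈ box (d + 1) N, -(1 / 2 : ℝ) * curvAdj F l (toSite r) = 0 := fun l => by
    rw [← Finset.mul_sum, sum_box_curvAdj_eq_zero (N := N) hF l, mul_zero]
  have hA : ∀ κ, IsPeriodic N (fun x => ∑' y, ∑ l, (-(1 / 2 : ℝ) * curvAdj F l y) * Gam (N := N) κ x l y) := fun κ x a =>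
    respA_periodic (N := N) (J := fun l y => -(1 / 2 : ℝ) * curvAdj F l y) hJp κ x a
  have hg : IsPeriodic N (codiff₁ (dz (fun z => ∑' y, ∑ l, (-(1 / 2 : ℝ) * curvAdj F l y) * GamM (N := N) z l y))) := by
    intro z a
    have hM : ∀ w, (∑' y, ∑ l, (-(1 / 2 : ℝ) * curvAdj F l y) * GamM (N := N) (w + (N : ℤ) • a) l y) =
        ∑' y, ∑ l, (-(1 / 2 : ℝ) * curvAdj F l y) * GamM (N := N) w l y := fun w =>
      respM_periodic (N := N) (J := fun l y => -(1 / 2 : ℝ) * curvAdj F l y) hJp w a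
    simp only [codiff₁, dz]
    refine Finset.sum_congr rfl fun k _ => ?_
    rw [show z + (N : ℤ) • a - unitVec k + unitVec k = (z - unitVec k + unitVec k) + (N : ℤ) • a by abel,
      show z + (N : ℤ) • a - unitVec k = (z - unitVec k) + (N : ℤ) • a by abel,
      show z + (N : ℤ) • a + unitVec k = (z + unitVec k) + (N : ℤ) • a by abel, hM, hM, hM, hM]
  have hel : ∀ μ y, curvAdj (curv (fun κ x => ∑' y, ∑ l, (-(1 / 2 : ℝ) * curvAdj F l y) * Gam (N := N) κ x l y)) μ y =
      dz (codiff₁ (dz (fun z => ∑' y, ∑ l, (-(1 / 2 : ℝ) * curvAdj F l y) * GamM (N := N) z l y))) μ y + -(1 / 2 : ℝ) * curvAdj F μ y :=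
    fun μ y => curvAdj_curv_resp_eq_dz_add (N := N) (J := fun l y => -(1 / 2 : ℝ) * curvAdj F l y) hJ hJp hJ0 μ y
  exact PeriodicCellPairing.card_mul_curv_add_half_eq (N := N) hA hF hFa hFcl hg hel κ l x

end Summit.QuantumFields.BalabanUV.Beta.GAN24.PeriodicKKTResponseFlux

end
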